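import Summits.HodgeConjecture.HodgeConjecture.Theorems.F0P3LettersOfClassificationShape  -- ★ p814159 (this seat): E1∕S2♭∕R♭ BY NAME from the §19b shape (C1)(C2)(C3); `shape_C3_iff`
import HarnessLib

/-!
# Crux `H413` — rung 4 glue, part 2 (PLAN.F0P3g3 §19c, rulings (U7)∕(U9)): print's ONE-ξ-PER-`P` form (C3₀) + family rigidity U♭
# ⇒ the sharpened conjunct (C3), hence R♭ BY NAME; S2♭ from (C3₀) alone; (C2) + (C3) ⇒ (C3₀)

F0∕P3 «U3-mult», cell `hodgecm-mathlib`, crux H413 (`stmt-HodgeConjecture-24833`); line of record `Cruxes/H413/Lines/F0_U3LettersRung1.lean`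
ED. 3 (open stubs `stub_E1`, `stub_S2`, `stub_R` = ★ named engine letters; `stub_betaOpp : StubBetaOppAdm := stub_betaOpp_of_letters stub_S2 stub_R`).
Companion of ★ `F0P3LettersOfClassificationShape` ((C1) ∧ (C2) ∧ (C3) ⇒ E1 ∧ S2♭ ∧ R♭; (C3) ⟺ R♭).  HERE (0 `def`, 0 `sorry`, 0 named fact;
pure logic over ★ D6 `MemXiFamily` and the ★ letter constants):
* (C3₀) — print's form of [Rogawski1990, Thm. 14.6.4 + §12.3 p. 178] read one `ξ` per cohomological `P`, TOKEN-INDEXED (ruling (U9)(a)):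
  ONE sign function `sgn : OneDimAutRepH L → ℤ` after the frame such that every `H¹`-token of type `δ ∈ {±1}` on `P.archModuleCM ι T hT`
  comes with a one-dimensional automorphic `ξ` with `MemXiFamily P … μω hμu ξ` and `δ = sgn ξ`;
* U♭ — family rigidity `MemXiFamily P … ξ → MemXiFamily P … ξ′ → ξ = ξ′` (UNGUARDED here; reachable in-house per PLAN §19c: ★ p814193
  `F0P3XiLocalLabelsOfMemXiFamily` (U♭-loc, split places) + F0P3-p01 (g6)'s torus split-rigidity (U♭-glob), in a GUARDED form — sibling file);
* §1 `shape_C3_of_C30_of_rigid : (∀ frame, C3₀) → (∀ frame, U♭) → (∀ frame, C3)`, `memXiFamily_cohTokens_sameType_of_C30_of_rigid` (R♭ BY NAME),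
  `cohDiscrete_memXiFamily_of_C30` (S2♭ BY NAME from (C3₀) alone), `shape_C30_of_C2_of_C3` (converse);
* the GUARDED-U♭ folds (ruling (U9)(b)) and the line's `StubBetaOppAdm` directly from (C3₀) + guarded U♭ + ★ T♭ are the sibling file
  `F0P3BetaOppAdmOfClassificationShape` (split for the 400-line rule).
HONEST LABEL: HC_CM is proved only modulo the printed citations until rung 0 closes.

References: [Rogawski1990] §12.3 p. 178 (Prop. 12.3.3 and the definition of `πⁿ(ξ)` before it); §14.6 Thm. 14.6.4 (p. 246); Thm. 13.3.6 (c);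
Thm. 13.3.5; Prop. 15.2.1; §15.3 ¶1.  [BernsteinZelevinsky1977] Thm. 2.9.  [BernsteinZelevinsky1976] §2.1.  [BorelWallach2000] II §5, VI Thm. 4.11.
-/

-- Mathlib idiom (as in ★ `GlobalAPacketLetters` ∕ ★ `F0P3LettersOfClassificationShape`): the commutator bracket on `Module.End ℂ M`,
-- needed to MENTION `(uFormGroup (Fin 2) (Fin 1)).lie →ₗ⁅ℝ⁆ Module.End ℂ M` in the token shapes.
attribute [local instance 100] LieRing.ofAssociativeRing

set_option autoImplicit false
set_option linter.dupNamespace false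

noncomputable section

open NumberField IsDedekindDomain MeasureTheory
open scoped Matrix ComplexOrder

namespace Summit.HodgeConjecture.HodgeConjecture.Cruxes.H413.F0P3LettersOfClassificationShapeRigid

open Literature.NumberTheory.Rogawski1990 Literature.NumberTheory.GaloisRepresentations
open Literature.NumberTheory.Automorphic Literature.NumberTheory.Automorphic.UnitaryGroup
open Literature.NumberTheory.Automorphic.UnitaryGroup.CotangentForms
open Literature.RepresentationTheory.BorelWallach2000
open Literature.RepresentationTheory.KonnoKonno2007 Literature.RepresentationTheory.KonnoKonno2007.RealDualPair
open Literature.RepresentationTheory.KonnoKonno2007.RealDualPair.UForm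
open Summit.HodgeConjecture.HodgeConjecture.Cruxes.H413.F0P3LettersOfClassificationShape
  (memXiFamily_cohTokens_sameType_of_shape)

/-! ## §1 (C3₀) + UNGUARDED U♭ ⇒ (C3); R♭ and S2♭ BY NAME; converse -/

/-- **(C3₀) + U♭ ⇒ (C3)** (pure logic).  (C3₀) is print's form of [Thm. 14.6.4 + §12.3 p. 178] read ONE `ξ` PER token: there is a sign
function `sgn` such that every `H¹`-token of type `δ` of a discrete `P` comes with SOME one-dimensional automorphic `ξ` whose family
contains `P` and `δ = sgn ξ`; U♭ (family rigidity) says the family of `P` is unique.  Then every `ξ` with `MemXiFamily P … ξ` IS that `ξ`,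
so its tokens read `sgn ξ`: (C3).  The engine may therefore deliver EITHER (C3) or (C3₀) (+ U♭ in-house).
[cite: Rogawski1990, §14.6 Thm. 14.6.4; §12.3 p. 178 (Prop. 12.3.3)] [cite: BernsteinZelevinsky1977, Thm. 2.9] -/
theorem shape_C3_of_C30_of_rigid
    (hC30 : ∀ (L : Type) [Field L] [NumberField L] [IsCMField L] (ι : L →+* ℂ) (H : Matrix (Fin 3) (Fin 3) L) (T : GL (Fin 3) ℂ)
      (hT : (T : Matrix (Fin 3) (Fin 3) ℂ)ᴴ * H.map ι * (T : Matrix (Fin 3) (Fin 3) ℂ) = Literature.Geometry.ComplexHyperbolic.BallModel.J),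
      (∀ τ' : L →+* ℂ, InfinitePlace.mk τ' ≠ InfinitePlace.mk ι → (H.map τ').PosDef) →
      2 ≤ Module.finrank ℚ ↥(maximalRealSubfield L) →
      ∀ (μ : Measure (adelicGroupData (↥(maximalRealSubfield L)) L (IsCMField.complexConj L) 3 H).automorphicQuotient)
        [(adelicGroupData (↥(maximalRealSubfield L)) L (IsCMField.complexConj L) 3 H).IsAutomorphicMeasure μ]
        (μω : HeckeCharacter L) (hμu : μω.IsUnitary),
        (∀ x : Literature.NumberTheory.GaloisRepresentations.ideleGroup ↥(maximalRealSubfield L),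
          μω (AdeleRing.ideleBaseChange (↥(maximalRealSubfield L)) L x) = quadraticHeckeCharCM L x) →
      ∃ sgn : OneDimAutRepH L → ℤ,
        ∀ (P : DiscreteAutomorphicRep (adelicGroupData (↥(maximalRealSubfield L)) L (IsCMField.complexConj L) 3 H) μ),
          ∀ (M : Type) [AddCommGroup M] [Module ℂ M] (σK : Representation ℂ (uFormGroup (Fin 2) (Fin 1)).maximalCompact M)
            (σ𝔤 : (uFormGroup (Fin 2) (Fin 1)).lie →ₗ⁅ℝ⁆ Module.End ℂ M) (hM : IsGKModule (uFormGroup (Fin 2) (Fin 1)) σK σ𝔤),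
            IsIrreducibleGK σK σ𝔤 →
            (∃ T₁ : P.archModuleCM ι T hT →ₗ[ℂ] M,
              (∀ (k : (uFormGroup (Fin 2) (Fin 1)).maximalCompact) (w : P.archModuleCM ι T hT),
                  T₁ (P.archRepKCM ι T hT k w) = σK k (T₁ w)) ∧
                (∀ (X : (uFormGroup (Fin 2) (Fin 1)).lie) (w : P.archModuleCM ι T hT),
                  T₁ (P.archRepLieCM ι T hT X w) = σ𝔤 X (T₁ w)) ∧ T₁ ≠ 0) →
            ∀ δ : ℤ, (δ = 1 ∨ δ = -1) → upqTypeClasses σK σ𝔤 hM.ad_compat 1 δ ≠ ⊥ →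
            ∃ ξ : OneDimAutRepH L, MemXiFamily P (transpose_map_cmConjRingHom_eq_of_frame L ι H T hT) (isUnit_det_of_frame L ι H T hT) μω hμu ξ ∧ δ = sgn ξ)
    (hU : ∀ (L : Type) [Field L] [NumberField L] [IsCMField L] (ι : L →+* ℂ) (H : Matrix (Fin 3) (Fin 3) L) (T : GL (Fin 3) ℂ)
      (hT : (T : Matrix (Fin 3) (Fin 3) ℂ)ᴴ * H.map ι * (T : Matrix (Fin 3) (Fin 3) ℂ) = Literature.Geometry.ComplexHyperbolic.BallModel.J),
      (∀ τ' : L →+* ℂ, InfinitePlace.mk τ' ≠ InfinitePlace.mk ι → (H.map τ').PosDef) →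
      2 ≤ Module.finrank ℚ ↥(maximalRealSubfield L) →
      ∀ (μ : Measure (adelicGroupData (↥(maximalRealSubfield L)) L (IsCMField.complexConj L) 3 H).automorphicQuotient)
        [(adelicGroupData (↥(maximalRealSubfield L)) L (IsCMField.complexConj L) 3 H).IsAutomorphicMeasure μ]
        (μω : HeckeCharacter L) (hμu : μω.IsUnitary),
        (∀ x : Literature.NumberTheory.GaloisRepresentations.ideleGroup ↥(maximalRealSubfield L),
          μω (AdeleRing.ideleBaseChange (↥(maximalRealSubfield L)) L x) = quadraticHeckeCharCM L x) →
      ∀ (P : DiscreteAutomorphicRep (adelicGroupData (↥(maximalRealSubfield L)) L (IsCMField.complexConj L) 3 H) μ)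
        (ξ ξ' : OneDimAutRepH L), MemXiFamily P (transpose_map_cmConjRingHom_eq_of_frame L ι H T hT) (isUnit_det_of_frame L ι H T hT) μω hμu ξ → MemXiFamily P (transpose_map_cmConjRingHom_eq_of_frame L ι H T hT) (isUnit_det_of_frame L ι H T hT) μω hμu ξ' → ξ = ξ') :
    ∀ (L : Type) [Field L] [NumberField L] [IsCMField L] (ι : L →+* ℂ) (H : Matrix (Fin 3) (Fin 3) L) (T : GL (Fin 3) ℂ)
      (hT : (T : Matrix (Fin 3) (Fin 3) ℂ)ᴴ * H.map ι * (T : Matrix (Fin 3) (Fin 3) ℂ) = Literature.Geometry.ComplexHyperbolic.BallModel.J),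
      (∀ τ' : L →+* ℂ, InfinitePlace.mk τ' ≠ InfinitePlace.mk ι → (H.map τ').PosDef) →
      2 ≤ Module.finrank ℚ ↥(maximalRealSubfield L) →
      ∀ (μ : Measure (adelicGroupData (↥(maximalRealSubfield L)) L (IsCMField.complexConj L) 3 H).automorphicQuotient)
        [(adelicGroupData (↥(maximalRealSubfield L)) L (IsCMField.complexConj L) 3 H).IsAutomorphicMeasure μ]
        (μω : HeckeCharacter L) (hμu : μω.IsUnitary),
        (∀ x : Literature.NumberTheory.GaloisRepresentations.ideleGroup ↥(maximalRealSubfield L),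
          μω (AdeleRing.ideleBaseChange (↥(maximalRealSubfield L)) L x) = quadraticHeckeCharCM L x) →
      ∃ sgn : OneDimAutRepH L → ℤ,
        ∀ (P : DiscreteAutomorphicRep (adelicGroupData (↥(maximalRealSubfield L)) L (IsCMField.complexConj L) 3 H) μ)
          (ξ : OneDimAutRepH L),
          MemXiFamily P (transpose_map_cmConjRingHom_eq_of_frame L ι H T hT) (isUnit_det_of_frame L ι H T hT) μω hμu ξ →
          ∀ (M : Type) [AddCommGroup M] [Module ℂ M] (σK : Representation ℂ (uFormGroup (Fin 2) (Fin 1)).maximalCompact M)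
            (σ𝔤 : (uFormGroup (Fin 2) (Fin 1)).lie →ₗ⁅ℝ⁆ Module.End ℂ M) (hM : IsGKModule (uFormGroup (Fin 2) (Fin 1)) σK σ𝔤),
            IsIrreducibleGK σK σ𝔤 →
            (∃ T₁ : P.archModuleCM ι T hT →ₗ[ℂ] M,
              (∀ (k : (uFormGroup (Fin 2) (Fin 1)).maximalCompact) (w : P.archModuleCM ι T hT),
                  T₁ (P.archRepKCM ι T hT k w) = σK k (T₁ w)) ∧
                (∀ (X : (uFormGroup (Fin 2) (Fin 1)).lie) (w : P.archModuleCM ι T hT),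
                  T₁ (P.archRepLieCM ι T hT X w) = σ𝔤 X (T₁ w)) ∧ T₁ ≠ 0) →
            ∀ δ : ℤ, (δ = 1 ∨ δ = -1) → upqTypeClasses σK σ𝔤 hM.ad_compat 1 δ ≠ ⊥ → δ = sgn ξ := by
  intro L _ _ _ ι H T hT hdef h2 μ _ μω hμu hμω
  obtain ⟨sgn, hsgn⟩ := hC30 L ι H T hT hdef h2 μ μω hμu hμω
  refine ⟨sgn, fun P ξ hP M _ _ σK σ𝔤 hM hirr hT₁ δ hδ hne => ?_⟩
  obtain ⟨ξ₀, hP₀, hδ₀⟩ := hsgn P M σK σ𝔤 hM hirr hT₁ δ hδ hne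
  rwa [hU L ι H T hT hdef h2 μ μω hμu hμω P ξ₀ ξ hP₀ hP] at hδ₀

/-- **R♭ BY NAME from (C3₀) + U♭** (`shape_C3_of_C30_of_rigid` ∘ ★ `memXiFamily_cohTokens_sameType_of_shape`).
[cite: Rogawski1990, §14.6 Thm. 14.6.4; §12.3 p. 178 (Prop. 12.3.3)] -/
theorem memXiFamily_cohTokens_sameType_of_C30_of_rigid
    (hC30 : ∀ (L : Type) [Field L] [NumberField L] [IsCMField L] (ι : L →+* ℂ) (H : Matrix (Fin 3) (Fin 3) L) (T : GL (Fin 3) ℂ)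
      (hT : (T : Matrix (Fin 3) (Fin 3) ℂ)ᴴ * H.map ι * (T : Matrix (Fin 3) (Fin 3) ℂ) = Literature.Geometry.ComplexHyperbolic.BallModel.J),
      (∀ τ' : L →+* ℂ, InfinitePlace.mk τ' ≠ InfinitePlace.mk ι → (H.map τ').PosDef) →
      2 ≤ Module.finrank ℚ ↥(maximalRealSubfield L) →
      ∀ (μ : Measure (adelicGroupData (↥(maximalRealSubfield L)) L (IsCMField.complexConj L) 3 H).automorphicQuotient)
        [(adelicGroupData (↥(maximalRealSubfield L)) L (IsCMField.complexConj L) 3 H).IsAutomorphicMeasure μ]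
        (μω : HeckeCharacter L) (hμu : μω.IsUnitary),
        (∀ x : Literature.NumberTheory.GaloisRepresentations.ideleGroup ↥(maximalRealSubfield L),
          μω (AdeleRing.ideleBaseChange (↥(maximalRealSubfield L)) L x) = quadraticHeckeCharCM L x) →
      ∃ sgn : OneDimAutRepH L → ℤ,
        ∀ (P : DiscreteAutomorphicRep (adelicGroupData (↥(maximalRealSubfield L)) L (IsCMField.complexConj L) 3 H) μ),
          ∀ (M : Type) [AddCommGroup M] [Module ℂ M] (σK : Representation ℂ (uFormGroup (Fin 2) (Fin 1)).maximalCompact M)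
            (σ𝔤 : (uFormGroup (Fin 2) (Fin 1)).lie →ₗ⁅ℝ⁆ Module.End ℂ M) (hM : IsGKModule (uFormGroup (Fin 2) (Fin 1)) σK σ𝔤),
            IsIrreducibleGK σK σ𝔤 →
            (∃ T₁ : P.archModuleCM ι T hT →ₗ[ℂ] M,
              (∀ (k : (uFormGroup (Fin 2) (Fin 1)).maximalCompact) (w : P.archModuleCM ι T hT),
                  T₁ (P.archRepKCM ι T hT k w) = σK k (T₁ w)) ∧
                (∀ (X : (uFormGroup (Fin 2) (Fin 1)).lie) (w : P.archModuleCM ι T hT),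
                  T₁ (P.archRepLieCM ι T hT X w) = σ𝔤 X (T₁ w)) ∧ T₁ ≠ 0) →
            ∀ δ : ℤ, (δ = 1 ∨ δ = -1) → upqTypeClasses σK σ𝔤 hM.ad_compat 1 δ ≠ ⊥ →
            ∃ ξ : OneDimAutRepH L, MemXiFamily P (transpose_map_cmConjRingHom_eq_of_frame L ι H T hT) (isUnit_det_of_frame L ι H T hT) μω hμu ξ ∧ δ = sgn ξ)
    (hU : ∀ (L : Type) [Field L] [NumberField L] [IsCMField L] (ι : L →+* ℂ) (H : Matrix (Fin 3) (Fin 3) L) (T : GL (Fin 3) ℂ)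
      (hT : (T : Matrix (Fin 3) (Fin 3) ℂ)ᴴ * H.map ι * (T : Matrix (Fin 3) (Fin 3) ℂ) = Literature.Geometry.ComplexHyperbolic.BallModel.J),
      (∀ τ' : L →+* ℂ, InfinitePlace.mk τ' ≠ InfinitePlace.mk ι → (H.map τ').PosDef) →
      2 ≤ Module.finrank ℚ ↥(maximalRealSubfield L) →
      ∀ (μ : Measure (adelicGroupData (↥(maximalRealSubfield L)) L (IsCMField.complexConj L) 3 H).automorphicQuotient)
        [(adelicGroupData (↥(maximalRealSubfield L)) L (IsCMField.complexConj L) 3 H).IsAutomorphicMeasure μ]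
        (μω : HeckeCharacter L) (hμu : μω.IsUnitary),
        (∀ x : Literature.NumberTheory.GaloisRepresentations.ideleGroup ↥(maximalRealSubfield L),
          μω (AdeleRing.ideleBaseChange (↥(maximalRealSubfield L)) L x) = quadraticHeckeCharCM L x) →
      ∀ (P : DiscreteAutomorphicRep (adelicGroupData (↥(maximalRealSubfield L)) L (IsCMField.complexConj L) 3 H) μ)
        (ξ ξ' : OneDimAutRepH L), MemXiFamily P (transpose_map_cmConjRingHom_eq_of_frame L ι H T hT) (isUnit_det_of_frame L ι H T hT) μω hμu ξ → MemXiFamily P (transpose_map_cmConjRingHom_eq_of_frame L ι H T hT) (isUnit_det_of_frame L ι H T hT) μω hμu ξ' → ξ = ξ') :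
    memXiFamily_cohTokens_sameType :=
  memXiFamily_cohTokens_sameType_of_shape (shape_C3_of_C30_of_rigid hC30 hU)

/-- **(C3₀) ⇒ (C2)**: print's one-ξ-per-token form already contains the membership clause, hence S2♭ BY NAME (no U♭ needed for S2♭).
[cite: Rogawski1990, §14.6 Thm. 14.6.4; Thm. 13.3.6 (c); §15.3 ¶1] -/
theorem cohDiscrete_memXiFamily_of_C30
    (hC30 : ∀ (L : Type) [Field L] [NumberField L] [IsCMField L] (ι : L →+* ℂ) (H : Matrix (Fin 3) (Fin 3) L) (T : GL (Fin 3) ℂ)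
      (hT : (T : Matrix (Fin 3) (Fin 3) ℂ)ᴴ * H.map ι * (T : Matrix (Fin 3) (Fin 3) ℂ) = Literature.Geometry.ComplexHyperbolic.BallModel.J),
      (∀ τ' : L →+* ℂ, InfinitePlace.mk τ' ≠ InfinitePlace.mk ι → (H.map τ').PosDef) →
      2 ≤ Module.finrank ℚ ↥(maximalRealSubfield L) →
      ∀ (μ : Measure (adelicGroupData (↥(maximalRealSubfield L)) L (IsCMField.complexConj L) 3 H).automorphicQuotient)
        [(adelicGroupData (↥(maximalRealSubfield L)) L (IsCMField.complexConj L) 3 H).IsAutomorphicMeasure μ]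
        (μω : HeckeCharacter L) (hμu : μω.IsUnitary),
        (∀ x : Literature.NumberTheory.GaloisRepresentations.ideleGroup ↥(maximalRealSubfield L),
          μω (AdeleRing.ideleBaseChange (↥(maximalRealSubfield L)) L x) = quadraticHeckeCharCM L x) →
      ∃ sgn : OneDimAutRepH L → ℤ,
        ∀ (P : DiscreteAutomorphicRep (adelicGroupData (↥(maximalRealSubfield L)) L (IsCMField.complexConj L) 3 H) μ),
          ∀ (M : Type) [AddCommGroup M] [Module ℂ M] (σK : Representation ℂ (uFormGroup (Fin 2) (Fin 1)).maximalCompact M)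
            (σ𝔤 : (uFormGroup (Fin 2) (Fin 1)).lie →ₗ⁅ℝ⁆ Module.End ℂ M) (hM : IsGKModule (uFormGroup (Fin 2) (Fin 1)) σK σ𝔤),
            IsIrreducibleGK σK σ𝔤 →
            (∃ T₁ : P.archModuleCM ι T hT →ₗ[ℂ] M,
              (∀ (k : (uFormGroup (Fin 2) (Fin 1)).maximalCompact) (w : P.archModuleCM ι T hT),
                  T₁ (P.archRepKCM ι T hT k w) = σK k (T₁ w)) ∧
                (∀ (X : (uFormGroup (Fin 2) (Fin 1)).lie) (w : P.archModuleCM ι T hT),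
                  T₁ (P.archRepLieCM ι T hT X w) = σ𝔤 X (T₁ w)) ∧ T₁ ≠ 0) →
            ∀ δ : ℤ, (δ = 1 ∨ δ = -1) → upqTypeClasses σK σ𝔤 hM.ad_compat 1 δ ≠ ⊥ →
            ∃ ξ : OneDimAutRepH L, MemXiFamily P (transpose_map_cmConjRingHom_eq_of_frame L ι H T hT) (isUnit_det_of_frame L ι H T hT) μω hμu ξ ∧ δ = sgn ξ) :
    cohDiscrete_memXiFamily := by
  intro L _ _ _ ι H T hT hdef h2 μ _ μω hμu hμω P M _ _ σK σ𝔤 hM hirr hT₁ δ hδ hne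
  obtain ⟨sgn, hsgn⟩ := hC30 L ι H T hT hdef h2 μ μω hμu hμω
  obtain ⟨ξ, hP, -⟩ := hsgn P M σK σ𝔤 hM hirr hT₁ δ hδ hne
  exact ⟨ξ, hP⟩

/-- **(C2) + (C3) ⇒ (C3₀)** (converse bookkeeping: the sharpened shape with its membership conjunct gives print's one-ξ-per-token form,
same `sgn`). [cite: Rogawski1990, §14.6 Thm. 14.6.4; §12.3 p. 178] -/
theorem shape_C30_of_C2_of_C3
    (hC2 : ∀ (L : Type) [Field L] [NumberField L] [IsCMField L] (ι : L →+* ℂ) (H : Matrix (Fin 3) (Fin 3) L) (T : GL (Fin 3) ℂ)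
      (hT : (T : Matrix (Fin 3) (Fin 3) ℂ)ᴴ * H.map ι * (T : Matrix (Fin 3) (Fin 3) ℂ) = Literature.Geometry.ComplexHyperbolic.BallModel.J),
      (∀ τ' : L →+* ℂ, InfinitePlace.mk τ' ≠ InfinitePlace.mk ι → (H.map τ').PosDef) →
      2 ≤ Module.finrank ℚ ↥(maximalRealSubfield L) →
      ∀ (μ : Measure (adelicGroupData (↥(maximalRealSubfield L)) L (IsCMField.complexConj L) 3 H).automorphicQuotient)
        [(adelicGroupData (↥(maximalRealSubfield L)) L (IsCMField.complexConj L) 3 H).IsAutomorphicMeasure μ]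
        (μω : HeckeCharacter L) (hμu : μω.IsUnitary),
        (∀ x : Literature.NumberTheory.GaloisRepresentations.ideleGroup ↥(maximalRealSubfield L),
          μω (AdeleRing.ideleBaseChange (↥(maximalRealSubfield L)) L x) = quadraticHeckeCharCM L x) →
      ∀ (P : DiscreteAutomorphicRep (adelicGroupData (↥(maximalRealSubfield L)) L (IsCMField.complexConj L) 3 H) μ),
          ∀ (M : Type) [AddCommGroup M] [Module ℂ M] (σK : Representation ℂ (uFormGroup (Fin 2) (Fin 1)).maximalCompact M)
            (σ𝔤 : (uFormGroup (Fin 2) (Fin 1)).lie →ₗ⁅ℝ⁆ Module.End ℂ M) (hM : IsGKModule (uFormGroup (Fin 2) (Fin 1)) σK σ𝔤),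
            IsIrreducibleGK σK σ𝔤 →
            (∃ T₁ : P.archModuleCM ι T hT →ₗ[ℂ] M,
              (∀ (k : (uFormGroup (Fin 2) (Fin 1)).maximalCompact) (w : P.archModuleCM ι T hT),
                  T₁ (P.archRepKCM ι T hT k w) = σK k (T₁ w)) ∧
                (∀ (X : (uFormGroup (Fin 2) (Fin 1)).lie) (w : P.archModuleCM ι T hT),
                  T₁ (P.archRepLieCM ι T hT X w) = σ𝔤 X (T₁ w)) ∧ T₁ ≠ 0) →
            ∀ δ : ℤ, (δ = 1 ∨ δ = -1) → upqTypeClasses σK σ𝔤 hM.ad_compat 1 δ ≠ ⊥ →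
            ∃ ξ : OneDimAutRepH L, MemXiFamily P (transpose_map_cmConjRingHom_eq_of_frame L ι H T hT) (isUnit_det_of_frame L ι H T hT) μω hμu ξ)
    (hC3 : ∀ (L : Type) [Field L] [NumberField L] [IsCMField L] (ι : L →+* ℂ) (H : Matrix (Fin 3) (Fin 3) L) (T : GL (Fin 3) ℂ)
      (hT : (T : Matrix (Fin 3) (Fin 3) ℂ)ᴴ * H.map ι * (T : Matrix (Fin 3) (Fin 3) ℂ) = Literature.Geometry.ComplexHyperbolic.BallModel.J),
      (∀ τ' : L →+* ℂ, InfinitePlace.mk τ' ≠ InfinitePlace.mk ι → (H.map τ').PosDef) →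
      2 ≤ Module.finrank ℚ ↥(maximalRealSubfield L) →
      ∀ (μ : Measure (adelicGroupData (↥(maximalRealSubfield L)) L (IsCMField.complexConj L) 3 H).automorphicQuotient)
        [(adelicGroupData (↥(maximalRealSubfield L)) L (IsCMField.complexConj L) 3 H).IsAutomorphicMeasure μ]
        (μω : HeckeCharacter L) (hμu : μω.IsUnitary),
        (∀ x : Literature.NumberTheory.GaloisRepresentations.ideleGroup ↥(maximalRealSubfield L),
          μω (AdeleRing.ideleBaseChange (↥(maximalRealSubfield L)) L x) = quadraticHeckeCharCM L x) →
      ∃ sgn : OneDimAutRepH L → ℤ,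
        ∀ (P : DiscreteAutomorphicRep (adelicGroupData (↥(maximalRealSubfield L)) L (IsCMField.complexConj L) 3 H) μ)
          (ξ : OneDimAutRepH L),
          MemXiFamily P (transpose_map_cmConjRingHom_eq_of_frame L ι H T hT) (isUnit_det_of_frame L ι H T hT) μω hμu ξ →
          ∀ (M : Type) [AddCommGroup M] [Module ℂ M] (σK : Representation ℂ (uFormGroup (Fin 2) (Fin 1)).maximalCompact M)
            (σ𝔤 : (uFormGroup (Fin 2) (Fin 1)).lie →ₗ⁅ℝ⁆ Module.End ℂ M) (hM : IsGKModule (uFormGroup (Fin 2) (Fin 1)) σK σ𝔤),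
            IsIrreducibleGK σK σ𝔤 →
            (∃ T₁ : P.archModuleCM ι T hT →ₗ[ℂ] M,
              (∀ (k : (uFormGroup (Fin 2) (Fin 1)).maximalCompact) (w : P.archModuleCM ι T hT),
                  T₁ (P.archRepKCM ι T hT k w) = σK k (T₁ w)) ∧
                (∀ (X : (uFormGroup (Fin 2) (Fin 1)).lie) (w : P.archModuleCM ι T hT),
                  T₁ (P.archRepLieCM ι T hT X w) = σ𝔤 X (T₁ w)) ∧ T₁ ≠ 0) →
            ∀ δ : ℤ, (δ = 1 ∨ δ = -1) → upqTypeClasses σK σ𝔤 hM.ad_compat 1 δ ≠ ⊥ → δ = sgn ξ) :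
    ∀ (L : Type) [Field L] [NumberField L] [IsCMField L] (ι : L →+* ℂ) (H : Matrix (Fin 3) (Fin 3) L) (T : GL (Fin 3) ℂ)
      (hT : (T : Matrix (Fin 3) (Fin 3) ℂ)ᴴ * H.map ι * (T : Matrix (Fin 3) (Fin 3) ℂ) = Literature.Geometry.ComplexHyperbolic.BallModel.J),
      (∀ τ' : L →+* ℂ, InfinitePlace.mk τ' ≠ InfinitePlace.mk ι → (H.map τ').PosDef) →
      2 ≤ Module.finrank ℚ ↥(maximalRealSubfield L) →
      ∀ (μ : Measure (adelicGroupData (↥(maximalRealSubfield L)) L (IsCMField.complexConj L) 3 H).automorphicQuotient)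
        [(adelicGroupData (↥(maximalRealSubfield L)) L (IsCMField.complexConj L) 3 H).IsAutomorphicMeasure μ]
        (μω : HeckeCharacter L) (hμu : μω.IsUnitary),
        (∀ x : Literature.NumberTheory.GaloisRepresentations.ideleGroup ↥(maximalRealSubfield L),
          μω (AdeleRing.ideleBaseChange (↥(maximalRealSubfield L)) L x) = quadraticHeckeCharCM L x) →
      ∃ sgn : OneDimAutRepH L → ℤ,
        ∀ (P : DiscreteAutomorphicRep (adelicGroupData (↥(maximalRealSubfield L)) L (IsCMField.complexConj L) 3 H) μ),
          ∀ (M : Type) [AddCommGroup M] [Module ℂ M] (σK : Representation ℂ (uFormGroup (Fin 2) (Fin 1)).maximalCompact M)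
            (σ𝔤 : (uFormGroup (Fin 2) (Fin 1)).lie →ₗ⁅ℝ⁆ Module.End ℂ M) (hM : IsGKModule (uFormGroup (Fin 2) (Fin 1)) σK σ𝔤),
            IsIrreducibleGK σK σ𝔤 →
            (∃ T₁ : P.archModuleCM ι T hT →ₗ[ℂ] M,
              (∀ (k : (uFormGroup (Fin 2) (Fin 1)).maximalCompact) (w : P.archModuleCM ι T hT),
                  T₁ (P.archRepKCM ι T hT k w) = σK k (T₁ w)) ∧
                (∀ (X : (uFormGroup (Fin 2) (Fin 1)).lie) (w : P.archModuleCM ι T hT),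
                  T₁ (P.archRepLieCM ι T hT X w) = σ𝔤 X (T₁ w)) ∧ T₁ ≠ 0) →
            ∀ δ : ℤ, (δ = 1 ∨ δ = -1) → upqTypeClasses σK σ𝔤 hM.ad_compat 1 δ ≠ ⊥ →
            ∃ ξ : OneDimAutRepH L, MemXiFamily P (transpose_map_cmConjRingHom_eq_of_frame L ι H T hT) (isUnit_det_of_frame L ι H T hT) μω hμu ξ ∧ δ = sgn ξ := by
  intro L _ _ _ ι H T hT hdef h2 μ _ μω hμu hμω
  obtain ⟨sgn, hsgn⟩ := hC3 L ι H T hT hdef h2 μ μω hμu hμω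
  refine ⟨sgn, fun P M _ _ σK σ𝔤 hM hirr hT₁ δ hδ hne => ?_⟩
  obtain ⟨ξ, hP⟩ := hC2 L ι H T hT hdef h2 μ μω hμu hμω P M σK σ𝔤 hM hirr hT₁ δ hδ hne
  exact ⟨ξ, hP, hsgn P ξ hP M σK σ𝔤 hM hirr hT₁ δ hδ hne⟩

end Summit.HodgeConjecture.HodgeConjecture.Cruxes.H413.F0P3LettersOfClassificationShapeRigid

end
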